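import Literature.NumberTheory.GaloisRepresentations.SUnitsLayerInvariantsRealisation
import Literature.NumberTheory.GaloisRepresentations.IdeleLocalInvariantsConjugation
import HarnessLib

/-!
# The invariant vector `θ_E(c) = (inv_w(ι c))_w` of a layer class `c ∈ H²(Gal(E/F), 𝒪_{E,S}ˣ)` and its behaviour under
# conjugation by `Gal(E/F₀)` for a tower `F₀ ⊆ F ⊆ E` (Tate, C–F VII §1.1, §7.3, §11; NSW (8.3.11))

Topic `NumberTheory/GaloisRepresentations`; namespace `Literature.NumberTheory.GaloisRepresentations.SUnits.Layers`
(§1–§3 in the type currency of `SUnitsIdeleBridge`, §4 in the intermediate-field currency of `SUnitsLayerInflation` /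
`SUnitsLayerInvariantsRealisation`).  Definitions with bodies (`sUnitsConjHom`, `sUnitsConj`, `invVec`) and theorems;
NO named fact, no `sorry`, no instance, no notation.  Lane «TATE-EPC-TC» of cell `bsd-eis` (crux `GoodLatticeBDPValue`,
stmt-BirchSwinnertonDyer-19032), FILE D part 1 (the `hH2` discharge): the finite-layer invariant vector, its
additivity, sum-zero, stability under inflation, injectivity modulo inflation, and Δ-equivariance.

Mathematics.  For number fields `K ⊆ F₀ ⊆ F ⊆ E` with `E/F₀` Galois and `F/F₀` normal, `S` a set of places of `K` and
`S_F` the places of `F` above `S`, a class `c ∈ H²(Gal(E/F), 𝒪_{E,S}ˣ)` has the INVARIANT VECTOR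
`θ(c) := (w ↦ inv_w(ι c))`, `ι : 𝒪_{E,S}ˣ → J_{E,S_F} ⊆ J_E` (-w4's bridge `sUnitsToIdeleS`, the tree's `localInv`).  An
element `t ∈ Gal(E/F₀)` acts on `H²(Gal(E/F), 𝒪_{E,S}ˣ)` by Serre's `σ_t = H²(g ↦ t⁻¹ g t, u ↦ t u)` (`sUnitsConj`, §1),
compatibly with `ι` and with `σ_t` on `H²(Gal(E/F), J_E)` (`ideleConj`, §2), whence by
`IdeleCohomology.localInv_ideleConj` **`θ(σ_t c)(w) = θ(c)((t|_F)⁻¹ w)`** (§3).  §4 packages, for intermediate fields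
`F₀ ≤ F ≤ E ⊆ K_S` of `K̄/K`: `θ` is additive, vanishes off `S_F`, sums to zero over `S_F` (`K` totally complex;
-w8's `sum_localInv_eq_zero`), is unchanged by inflation to a bigger layer (`localInv_layerInf`), DETECTS classes modulo
inflation (`θ c = θ c' ⇒ Inf c = Inf c'` in a bigger layer: joint injectivity of the invariants over a totally complex base
+ -w4's capitulation supply), and transforms under `σ_t` as displayed.

## What is formalised
§1 `sUnitsConjHom`, **`sUnitsConj F₀ F E t n`**; §2 `map_ι_sUnitsConj`; §3 **`localInv_ι_sUnitsConj`**; §4 **`invVec`**,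
`invVec_add`, `invVec_zero`, `invVec_eq_zero_of_not_mem`, **`sum_invVec_eq_zero`**, **`invVec_layerInf`**,
**`exists_layerInf_eq_of_invVec_eq`**, **`invVec_sUnitsConj`**.

HONEST FRAMING: bookkeeping on landed theorems (class field theory of the finite layers); no statement of a Summit, of
Tate's theorem or of the crux is proved here; 0 cells / labels / tiers move.

## References
* J. W. S. Cassels, A. Fröhlich (eds.), *Algebraic Number Theory* (1967), Ch. VII (Tate) §1.1, §7.3 Cor. 7.4, §11.2.
  [CasselsFrohlichANT1967]
* J. Neukirch, A. Schmidt, K. Wingberg, *Cohomology of Number Fields*, 2nd ed. (2008), VIII §3 (8.3.10)–(8.3.11).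
  [NeukirchSchmidtWingberg2008]
* J.-P. Serre, *Local Fields*, GTM 67 (1979), Ch. VII §5. [SerreLocalFields1979]
-/

noncomputable section

open NumberField IsDedekindDomain Field IntermediateField CategoryTheory groupCohomology
open Literature.NumberTheory.GaloisRepresentations.OpenSubgroupLayer (algOfLE isScalarTower_algOfLE)
open Literature.NumberTheory.GaloisRepresentations.LocalWeilDatum
open Literature.NumberTheory.Automorphic

namespace Literature.NumberTheory.GaloisRepresentations

namespace SUnits

namespace Layers

open IdeleCohomology

/-! ## §1. Serre's `σ_t` on `Hⁿ(Gal(E/F), 𝒪_{E,S}ˣ)` for `t ∈ Gal(E/F₀)` -/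

section Conj

variable {K F₀ F E : Type} [Field K] [NumberField K] [Field F₀] [Field F] [Field E]
  [Algebra K F₀] [Algebra K F] [Algebra K E] [Algebra F₀ F] [Algebra F E] [Algebra F₀ E]
  [IsScalarTower K F₀ E] [IsScalarTower K F E] [IsScalarTower F₀ F E] [Normal F₀ F]
  (S : Set (HeightOneSpectrum (𝓞 K)))

variable (F₀ F E) in
/-- **The module component `u ↦ t u` of `σ_t` on `𝒪_{E,S}ˣ`**: `Res_{t⁻¹·t} 𝒪_{E,S}ˣ ⟶ 𝒪_{E,S}ˣ` as `Gal(E/F)`-modules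
(the action of `t ∈ Gal(E/F₀)` through `sUnitsRep K S F₀ E`). [cite: SerreLocalFields1979, Ch. VII §5] -/
def sUnitsConjHom (t : E ≃ₐ[F₀] E) :
    Rep.res (galConjOver F t) (sUnitsRep K S F E) ⟶ sUnitsRep K S F E :=
  Rep.ofHom ⟨(sUnitsRep K S F₀ E).ρ t, fun g => LinearMap.ext fun x => by
    apply (Additive.toMul (α := sUnits K S E)).injective
    refine Subtype.ext (Units.ext ?_)
    change ((t • ((galConjOver F t g) • ((Additive.toMul x : sUnits K S E) : Eˣ) : Eˣ) : Eˣ) : E) =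
      ((g • (t • ((Additive.toMul x : sUnits K S E) : Eˣ) : Eˣ) : Eˣ) : E)
    change t (galConjOver F t g (((Additive.toMul x : sUnits K S E) : Eˣ) : E)) =
      g (t (((Additive.toMul x : sUnits K S E) : Eˣ) : E))
    rw [galConjOver_apply, AlgEquiv.apply_symm_apply]⟩

/-- Unfolding: `sUnitsConjHom` is `x ↦ t • x`. [cite: SerreLocalFields1979, Ch. VII §5] -/
theorem sUnitsConjHom_hom_apply (t : E ≃ₐ[F₀] E) (x : Additive (sUnits K S E)) :
    (sUnitsConjHom F₀ F E S t).hom x = (sUnitsRep K S F₀ E).ρ t x := rfl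

variable (F₀ F E) in
/-- **Serre's `σ_t : Hⁿ(Gal(E/F), 𝒪_{E,S}ˣ) ⟶ Hⁿ(Gal(E/F), 𝒪_{E,S}ˣ)`** for `t ∈ Gal(E/F₀)`: `Hⁿ(g ↦ t⁻¹ g t, u ↦ t u)`
(the convention of `IdeleCohomology.ideleConj`). [cite: SerreLocalFields1979, Ch. VII §5] -/
def sUnitsConj (t : E ≃ₐ[F₀] E) (n : ℕ) :
    groupCohomology (sUnitsRep K S F E) n ⟶ groupCohomology (sUnitsRep K S F E) n :=
  groupCohomology.map (galConjOver F t) (sUnitsConjHom F₀ F E S t) n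

/-! ## §2. `ι ∘ σ_t = σ_t ∘ ι` for the bridge `ι : 𝒪_{E,S}ˣ → J_{E,S_F} ⊆ J_E` -/

variable [NumberField F] [NumberField E] (S_F : Finset (HeightOneSpectrum (𝓞 F)))
  (hSF : ∀ u : HeightOneSpectrum (𝓞 F), u ∈ S_F ↔ u.under (𝓞 K) ∈ S)

/-- **`H²(ι) (σ_t c) = σ_t (H²(ι) c)`** with `ι = ideleSRepHom ∘ sUnitsToIdeleS : 𝒪_{E,S}ˣ → J_E` (the principal idèle is
`Gal(E/F₀)`-equivariant, `principal_smul`). [cite: SerreLocalFields1979, Ch. VII §5][cite: CasselsFrohlichANT1967, Ch. VII §1.1] -/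
theorem map_ι_sUnitsConj (t : E ≃ₐ[F₀] E) (n : ℕ) (c : groupCohomology (sUnitsRep K S F E) n) :
    groupCohomology.map (MonoidHom.id _) (ideleSRepHom S_F) n
        (groupCohomology.map (MonoidHom.id _) (sUnitsToIdeleS (K := K) (F := F) (E := E) S S_F hSF) n
          (sUnitsConj F₀ F E S t n c)) =
      ideleConj F₀ F E t n
        (groupCohomology.map (MonoidHom.id _) (ideleSRepHom S_F) n
          (groupCohomology.map (MonoidHom.id _) (sUnitsToIdeleS (K := K) (F := F) (E := E) S S_F hSF) n c)) := by
  have key : sUnitsConj F₀ F E S t n ≫ groupCohomology.map (MonoidHom.id _)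
        (sUnitsToIdeleS (K := K) (F := F) (E := E) S S_F hSF) n ≫ groupCohomology.map (MonoidHom.id _) (ideleSRepHom S_F) n =
      groupCohomology.map (MonoidHom.id _) (sUnitsToIdeleS (K := K) (F := F) (E := E) S S_F hSF) n ≫
        groupCohomology.map (MonoidHom.id _) (ideleSRepHom S_F) n ≫ ideleConj F₀ F E t n := by
    rw [sUnitsConj, ideleConj]
    simp only [← groupCohomology.map_comp]
    refine Literature.Algebra.Homology.map_congr' ?_ _ _ (fun x => ?_) n
    · ext g; rfl
    · apply (Additive.toMul (α := ideleGroup E)).injective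
      change IdeleHerbrand.principal E ((Additive.toMul ((sUnitsRep K S F₀ E).ρ t x) : sUnits K S E) : Eˣ) =
        t • IdeleHerbrand.principal E ((Additive.toMul x : sUnits K S E) : Eˣ)
      rw [coe_toMul_sUnitsRep_ρ]
      exact IdeleHerbrand.principal_smul t _
  simpa only [ModuleCat.hom_comp, LinearMap.comp_apply] using congrArg (fun φ => φ.hom c) key

/-! ## §3. `inv_w(ι σ_t c) = inv_{(t|_F)⁻¹ w}(ι c)` -/

/-- **The invariants of `σ_t c`**: `localInv E w (ι (σ_t c)) = localInv E ((t|_F)⁻¹ • w) (ι c)` for `t ∈ Gal(E/F₀)`,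
`E/F₀` Galois, `F/F₀` normal (§2 and `IdeleCohomology.localInv_ideleConj`).
[cite: CasselsFrohlichANT1967, Ch. VII §1.1, §7.3][cite: SerreLocalFields1979, Ch. VII §5] -/
theorem localInv_ι_sUnitsConj [NumberField F₀] [IsGalois F₀ E] (t : E ≃ₐ[F₀] E) (w : HeightOneSpectrum (𝓞 F))
    (c : groupCohomology (sUnitsRep K S F E) 2) :
    haveI : IsGalois F E := IsGalois.tower_top_of_isGalois F₀ F E
    localInv E w (groupCohomology.map (MonoidHom.id _) (ideleSRepHom S_F) 2
        (groupCohomology.map (MonoidHom.id _) (sUnitsToIdeleS (K := K) (F := F) (E := E) S S_F hSF) 2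
          (sUnitsConj F₀ F E S t 2 c))) =
      localInv E ((t.restrictNormal F)⁻¹ • w) (groupCohomology.map (MonoidHom.id _) (ideleSRepHom S_F) 2
        (groupCohomology.map (MonoidHom.id _) (sUnitsToIdeleS (K := K) (F := F) (E := E) S S_F hSF) 2 c)) := by
  rw [map_ι_sUnitsConj]
  exact localInv_ideleConj t w _

end Conj

/-! ## §4. The invariant vector of a layer class, for intermediate fields `F₀ ≤ F ≤ E ⊆ K_S` of `K̄/K` -/

section Layer

variable {K : Type} [Field K] [NumberField K] (S : Set (HeightOneSpectrum (𝓞 K)))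
  {F E : IntermediateField K (AlgebraicClosure K)} [NumberField F] [FiniteDimensional K E] [IsGalois K E] (hF : F ≤ E)
  (S_F : Finset (HeightOneSpectrum (𝓞 F))) (hSF : ∀ u : HeightOneSpectrum (𝓞 F), u ∈ S_F ↔ u.under (𝓞 K) ∈ S)

/-- **The invariant vector `θ(c) = (w ↦ inv_w(ι c))`** of a layer class `c ∈ H²(Gal(E/F), 𝒪_{E,S}ˣ)` (`F ≤ E ⊆ K̄`
intermediate fields, `E/K` finite Galois): the tree's local invariant at the finite place `w` of `F` of the image of `c`
in `H²(Gal(E/F), J_E)` under -w4's bridge. [cite: CasselsFrohlichANT1967, Ch. VII §7.3 Cor. 7.4 (b)]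
[cite: NeukirchSchmidtWingberg2008, VIII §3 (8.3.11)] -/
def invVec (c : letI := algOfLE hF; groupCohomology (sUnitsRep K S F E) 2) (w : HeightOneSpectrum (𝓞 F)) :
    AddCircle (1 : ℚ) :=
  letI := algOfLE hF
  haveI := isScalarTower_algOfLE (K := K) hF
  haveI : NumberField E := NumberField.of_module_finite K E
  haveI : IsGalois F E := IsGalois.tower_top_of_isGalois K F E
  localInv E w (groupCohomology.map (MonoidHom.id _) (ideleSRepHom S_F) 2
    (groupCohomology.map (MonoidHom.id _) (sUnitsToIdeleS (K := K) (F := F) (E := E) S S_F hSF) 2 c))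

/-- Unfolding `invVec`. [cite: CasselsFrohlichANT1967, Ch. VII §7.3 Cor. 7.4 (b)] -/
theorem invVec_apply (c : letI := algOfLE hF; groupCohomology (sUnitsRep K S F E) 2) (w : HeightOneSpectrum (𝓞 F)) :
    invVec S hF S_F hSF c w =
      (letI := algOfLE hF
       haveI := isScalarTower_algOfLE (K := K) hF
       haveI : NumberField E := NumberField.of_module_finite K E
       haveI : IsGalois F E := IsGalois.tower_top_of_isGalois K F E
       localInv E w (groupCohomology.map (MonoidHom.id _) (ideleSRepHom S_F) 2
         (groupCohomology.map (MonoidHom.id _) (sUnitsToIdeleS (K := K) (F := F) (E := E) S S_F hSF) 2 c))) := rfl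

/-- `θ` is additive. [cite: CasselsFrohlichANT1967, Ch. VII §7.3] -/
theorem invVec_add (c c' : letI := algOfLE hF; groupCohomology (sUnitsRep K S F E) 2) :
    invVec S hF S_F hSF (c + c') = invVec S hF S_F hSF c + invVec S hF S_F hSF c' := by
  funext w
  simp only [invVec, Pi.add_apply, map_add]

/-- `θ(0) = 0`. [cite: CasselsFrohlichANT1967, Ch. VII §7.3] -/
theorem invVec_zero : invVec S hF S_F hSF (0 : letI := algOfLE hF; groupCohomology (sUnitsRep K S F E) 2) = 0 := by
  funext w
  simp only [invVec, Pi.zero_apply, map_zero]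

/-- `θ(c - c') = θ c - θ c'`. [cite: CasselsFrohlichANT1967, Ch. VII §7.3] -/
theorem invVec_sub (c c' : letI := algOfLE hF; groupCohomology (sUnitsRep K S F E) 2) :
    invVec S hF S_F hSF (c - c') = invVec S hF S_F hSF c - invVec S hF S_F hSF c' := by
  funext w
  simp only [invVec, Pi.sub_apply, map_sub]

/-- **`θ(c)` vanishes off `S_F`** when `E ⊆ K_S` (`E/F` unramified outside `S_F`).
[cite: CasselsFrohlichANT1967, Ch. VII §7.3 Cor. 7.4][cite: NeukirchSchmidtWingberg2008, VIII §3 (8.3.10)] -/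
theorem invVec_eq_zero_of_not_mem (hS : ramificationSubgroup K S ≤ galFixing K E)
    (c : letI := algOfLE hF; groupCohomology (sUnitsRep K S F E) 2) {w : HeightOneSpectrum (𝓞 F)} (hw : w ∉ S_F) :
    invVec S hF S_F hSF c w = 0 := by
  letI := algOfLE hF
  haveI := isScalarTower_algOfLE (K := K) hF
  haveI : NumberField E := NumberField.of_module_finite K E
  haveI : IsGalois F E := IsGalois.tower_top_of_isGalois K F E
  have hunr : ∀ v : HeightOneSpectrum (𝓞 F), v ∉ S_F → Algebra.IsUnramifiedIn (𝓞 E) v.asIdeal :=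
    fun v hv => isUnramifiedIn_of_le_of_ramificationSubgroup_le_galFixing S hF hS v fun h' => hv ((hSF v).2 h')
  exact localInv_map_ideleSRepHom_eq_zero_of_notMem S_F hunr hw _

/-- **`Σ_{w ∈ S_F} θ(c)(w) = 0`** (`K` totally complex, `E ⊆ K_S`; -w8's `sum_localInv_eq_zero`).
[cite: NeukirchSchmidtWingberg2008, VIII §3 (8.3.10)–(8.3.11)][cite: CasselsFrohlichANT1967, Ch. VII §11.2] -/
theorem sum_invVec_eq_zero [IsTotallyComplex K] (hS : ramificationSubgroup K S ≤ galFixing K E)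
    (c : letI := algOfLE hF; groupCohomology (sUnitsRep K S F E) 2) : ∑ w ∈ S_F, invVec S hF S_F hSF c w = 0 :=
  sum_localInv_eq_zero S hF hS S_F hSF c

/-- **`θ(Inf c) = θ(c)`** for a bigger layer `E ≤ E'` (-w8's `localInv_layerInf`).
[cite: CasselsFrohlichANT1967, Ch. VII §11.1][cite: NeukirchSchmidtWingberg2008, VIII §3 (8.3.11)] -/
theorem invVec_layerInf {E' : IntermediateField K (AlgebraicClosure K)} [FiniteDimensional K E'] [IsGalois K E'] (hEE' : E ≤ E')
    (c : letI := algOfLE hF; groupCohomology (sUnitsRep K S F E) 2) :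
    invVec S (hF.trans hEE') S_F hSF (layerInf S hF hEE' 2 c) = invVec S hF S_F hSF c := by
  funext w
  exact localInv_layerInf S hF hEE' S_F hSF c w

/-- **`θ` detects classes modulo inflation**: if `θ c = θ c'` then `Inf c = Inf c'` in some bigger layer `E' ⊆ K_S`
(`K` totally complex, `E ⊆ K_S`: the difference has all invariants at `S_F` zero, so its image in `H²(Gal(E/F), J_{E,S_F})`
vanishes — joint injectivity over a totally complex base — and it capitulates in a bigger layer, -w4's supply).
[cite: NeukirchSchmidtWingberg2008, VIII §3 (8.3.11) (ii)/(iii) (proof)][cite: CasselsFrohlichANT1967, Ch. VII §7.3 Prop. 7.3] -/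
theorem exists_layerInf_eq_of_invVec_eq [IsTotallyComplex K] (hS : ramificationSubgroup K S ≤ galFixing K E)
    (c c' : letI := algOfLE hF; groupCohomology (sUnitsRep K S F E) 2) (h : invVec S hF S_F hSF c = invVec S hF S_F hSF c') :
    ∃ (E' : IntermediateField K (AlgebraicClosure K)) (_ : FiniteDimensional K E') (_ : IsGalois K E') (hEE' : E ≤ E')
      (_ : ramificationSubgroup K S ≤ galFixing K E'), layerInf S hF hEE' 2 c = layerInf S hF hEE' 2 c' := by
  letI := algOfLE hF
  haveI := isScalarTower_algOfLE (K := K) hF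
  haveI : NumberField E := NumberField.of_module_finite K E
  haveI : IsGalois F E := IsGalois.tower_top_of_isGalois K F E
  haveI : IsTotallyComplex F := isTotallyComplex_of_algebra K F
  have hunr : ∀ v : HeightOneSpectrum (𝓞 F), v ∉ S_F → Algebra.IsUnramifiedIn (𝓞 E) v.asIdeal :=
    fun v hv => isUnramifiedIn_of_le_of_ramificationSubgroup_le_galFixing S hF hS v fun h' => hv ((hSF v).2 h')
  -- `ι (c - c')` has all invariants zero at `S_F`, hence vanishes
  have h0 : groupCohomology.map (MonoidHom.id _) (sUnitsToIdeleS (K := K) (F := F) (E := E) S S_F hSF) 2 (c - c') = 0 := by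
    refine eq_zero_of_forall_mem_localInv_eq_zero S_F hunr _ fun v _ => ?_
    have hv := congrFun h v
    rw [invVec_apply, invVec_apply] at hv
    rw [map_sub, map_sub, map_sub, sub_eq_zero]
    exact hv
  obtain ⟨E', hfd', hgal', hEE', hS', hz⟩ :=
    exists_layerInf_two_eq_zero_of_map_sUnitsToIdeleS_eq_zero S hF hS S_F hSF (c - c') h0
  refine ⟨E', hfd', hgal', hEE', hS', ?_⟩
  rwa [map_sub, sub_eq_zero] at hz

/-- **`θ(σ_t c)(w) = θ(c)((t|_F)⁻¹ w)`** for `t ∈ Gal(E/F₀)`, a tower of intermediate fields `F₀ ≤ F ≤ E` with `F/K` normal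
(§3 in the intermediate-field currency; `σ_t = sUnitsConj`). [cite: CasselsFrohlichANT1967, Ch. VII §1.1, §7.3]
[cite: SerreLocalFields1979, Ch. VII §5] -/
theorem invVec_sUnitsConj {F₀ : IntermediateField K (AlgebraicClosure K)} [NumberField F₀] [Normal K F] (hF₀ : F₀ ≤ F)
    (t : letI := algOfLE (hF₀.trans hF); E ≃ₐ[F₀] E) (c : letI := algOfLE hF; groupCohomology (sUnitsRep K S F E) 2)
    (w : HeightOneSpectrum (𝓞 F)) :
    letI := algOfLE hF₀
    letI := algOfLE hF
    letI := algOfLE (hF₀.trans hF)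
    haveI := isScalarTower_algOfLE₃ hF₀ hF
    haveI := normal_algOfLE (K := K) hF₀
    haveI := isScalarTower_algOfLE (K := K) (hF₀.trans hF)
    invVec S hF S_F hSF (sUnitsConj (↥F₀) (↥F) (↥E) S t 2 c) w = invVec S hF S_F hSF c ((t.restrictNormal F)⁻¹ • w) := by
  letI := algOfLE hF₀
  letI := algOfLE hF
  letI := algOfLE (hF₀.trans hF)
  haveI := isScalarTower_algOfLE₃ hF₀ hF
  haveI := normal_algOfLE (K := K) hF₀
  haveI := isScalarTower_algOfLE (K := K) hF
  haveI := isScalarTower_algOfLE (K := K) (hF₀.trans hF)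
  haveI : NumberField E := NumberField.of_module_finite K E
  haveI : IsGalois F₀ E := IsGalois.tower_top_of_isGalois K F₀ E
  rw [invVec_apply, invVec_apply, map_ι_sUnitsConj]
  have h2 := localInv_ideleConj (F := ↥F₀) (K := ↥F) (E := ↥E) t w
    (groupCohomology.map (MonoidHom.id _) (ideleSRepHom S_F) 2
      (groupCohomology.map (MonoidHom.id _) (sUnitsToIdeleS (K := K) (F := ↥F) (E := ↥E) S S_F hSF) 2 c))
  convert h2 using 2

end Layer

end Layers

end SUnits

end Literature.NumberTheory.GaloisRepresentations

end
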